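import Mathlib.Geometry.Manifold.Instances.Sphere
import Mathlib.Geometry.Manifold.Diffeomorph
import Mathlib.AlgebraicTopology.FundamentalGroupoid.SimplyConnected
import Literature.Geometry.Riemannian.WeylEnergy
import HarnessLib

/-!
# The Chang–Gursky–Yang conformally invariant sphere theorem in dimension four (named fact)

Chang–Gursky–Yang 2003, Theorem A (Publ. Math. IHÉS 98; arXiv:math/0309287, p. 2), verbatim:
"Let `(M⁴, g)` be a smooth, closed four-manifold for which (i) the Yamabe invariant
`Y(M⁴, g) > 0`, and (ii) the Weyl curvature satisfies `∫_{M⁴} |W|² dvol < 16π² χ(M⁴)` (0.3).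
Then `M⁴` is diffeomorphic to either `S⁴` or `ℝP⁴`." Here `|W|² = W_{ijkl}W^{ijkl}` is the
`(0,4)`-norm (ibid., Remark 2) and `Y(M⁴, g) = inf_{g̃ ∈ [g]} vol(g̃)^{-1/2} ∫ R_{g̃} dvol_{g̃}`
(ibid., Remark 1). Equivalent form Thm. A′ via Chern–Gauss–Bonnet
`8π² χ = ∫ (¼|W|² - ½|E|² + R²/24) dvol` (0.4): `Y > 0` and `∫ (-½|E|² + R²/24 - ¼|W|²) dvol > 0`
give the same conclusion. The proof passes from integral to pointwise pinching by a fully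
nonlinear conformal deformation ([CGY1], [CGY2]) and concludes with Margerin's weak-pinching
sphere theorem (Margerin 1998).

This file vendors ONE named fact, in the **simply connected, `scal > 0` special case** requested
by route `SmoothPoincare4/PIC` (crux `WeylEnergyPinching`, item stmt-SmoothPoincare4-1670,
hypothesis `hCGY` of its branch assembly; ledger cite item wi-08967), over the Weyl energy
`g.weylEnergy = ∫_M |W_g|² dV_g` of `WeylEnergy.lean`:

* `changGurskyYang_sphere_four` — for every compact simply connected smooth `4`-manifold `M`
  (summit binder of `SmoothPoincare4`: Hausdorff, second countable, `C^∞` atlas modelled on `ℝ⁴`)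
  carrying a Riemannian metric `g` with `scal_g > 0` everywhere and `∫_M |W_g|² dV_g < 32π²`,
  `M` is diffeomorphic to `S⁴`.

## Why this is (no more than) Theorem A

The special case follows from Theorem A as printed together with three classical facts, each
weaker to state than the vocabulary Theorem A itself needs (Yamabe invariant, Euler
characteristic, `ℝP⁴`), which is why the route asked for this form:
(1) `scal_g ≥ R₀ > 0` on a closed manifold gives `Y(M,[g]) > 0` (the Yamabe quotient
`Q_g(φ) = ∫(a|dφ|² + Rφ²) dV / ‖φ‖²_{L^p}`, `p = 2n/(n-2)`, is bounded below by
`min(a, R₀)/C_S² > 0`, `C_S` the constant of the Sobolev embedding `W^{1,2} ⊂ L^p`; Lee–Parker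
1987, (1.5) for the definition of `λ(M) = Y(M,[g])` and Thm. 2.2 for the embedding); (2) a closed
simply connected `4`-manifold is orientable with `b₁ = b₃ = 0`, so `χ(M) = 2 + b₂(M) ≥ 2` and
`32π² ≤ 16π² χ(M)` (Poincaré duality, Hatcher 2002, Thm. 3.30); (3) `π₁(ℝP⁴) = ℤ/2 ≠ 1` excludes
the second alternative. No statement stronger than
Theorem A + (1)–(3) is vendored; in particular the sharp constant `16π² χ(M)` is replaced by its
lower bound `32π²`, never by anything larger.

## Cone hygiene

This is a FACT file (one `def … : Prop`, no `_holds`: Theorem A is a deep theorem — fully nonlinear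
elliptic PDE plus Ricci flow — far from formalisable now). It is deliberately separate from the
fact-free definition file `WeylEnergy.lean`, so that routes can import the definition without
importing this unproved fact (reconciler guardrail `provers_require_clean_cone`); a route that
wants the fact takes it as an explicit hypothesis `(h : changGurskyYang_sphere_four)` or inlines
its text.

## References

* S.-Y. A. Chang, M. J. Gursky, P. C. Yang, *A conformally invariant sphere theorem in four
  dimensions*, Publ. Math. IHÉS 98 (2003) 105–143, arXiv:math/0309287, Thm. A, Thm. A′, (0.1)–(0.5),
  Remarks 1–2. [ChangGurskyYang2003]
* C. Margerin, *A sharp characterization of the smooth 4-sphere in curvature terms*, Comm. Anal.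
  Geom. 6 (1998) 21–65 (the weak pinching theorem used in the proof). [Margerin1998]
* J. M. Lee, T. H. Parker, *The Yamabe problem*, Bull. AMS 17 (1987) 37–91, (1.5) (the invariant
  `λ(M)`), Thm. 2.2 (Sobolev embedding on compact manifolds). [LeeParker1987]
* A. Hatcher, *Algebraic Topology* (2002), Thm. 3.30 (Poincaré duality). [Hatcher2002]
-/

noncomputable section

open scoped Manifold ContDiff ENNReal

namespace Literature.Geometry.Riemannian

open Literature.Geometry.Lorentzian (PseudoRiemannianMetric)

/-- **Chang–Gursky–Yang conformally invariant sphere theorem, simply connected `scal > 0` case**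
(Chang–Gursky–Yang 2003, Thm. A: "Let `(M⁴, g)` be a smooth, closed four-manifold for which (i)
the Yamabe invariant `Y(M⁴,g) > 0`, and (ii) the Weyl curvature satisfies
`∫_{M⁴} |W|² dvol < 16π² χ(M⁴)`. Then `M⁴` is diffeomorphic to either `S⁴` or `ℝP⁴`", with the
`(0,4)`-norm `|W|² = W_{ijkl}W^{ijkl}`, Remark 2). SPECIAL CASE vendored here: for every compact,
simply connected, Hausdorff, second countable `C^∞` `4`-manifold `M` modelled on `ℝ⁴`, if `M`
carries a `C^∞` Riemannian metric `g` on `TM` (with its Levi-Civita connection,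
`[g.HasLeviCivita]`) of everywhere positive scalar curvature whose Weyl energy
`g.weylEnergy = ∫_M |W_g|² dV_g` (`WeylEnergy.lean`, CGY's normalisation (0.3)) is `< 32π²`, then
`M` is `C^∞`-diffeomorphic to the round `S⁴ ⊂ ℝ⁵`. Reduction to Thm. A as printed: `scal_g > 0`
gives `Y(M,[g]) > 0` (Sobolev embedding; Lee–Parker 1987, (1.5) and Thm. 2.2); `π₁(M) = 1` and
closedness give orientability, `b₁ = b₃ = 0`, `χ(M) = 2 + b₂ ≥ 2`, so
`∫|W|² < 32π² ≤ 16π² χ(M)` (Hatcher 2002, Thm. 3.30); and `π₁(ℝP⁴) ≠ 1` rules out `ℝP⁴`. Hypotheses complete (compactness = "closed": the charts are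
boundaryless). A deep theorem (fully nonlinear conformal PDE + Margerin's Ricci-flow pinching
theorem): no `_holds`. [cite: ChangGurskyYang2003, Thm. A] -/
def changGurskyYang_sphere_four : Prop :=
  ∀ (M : Type) [TopologicalSpace M] [T2Space M] [SecondCountableTopology M]
    [ChartedSpace (EuclideanSpace ℝ (Fin 4)) M] [IsManifold (𝓡 4) ∞ M] [CompactSpace M]
    [SimplyConnectedSpace M],
    (∃ g : PseudoRiemannianMetric (𝓡 4) ∞ (EuclideanSpace ℝ (Fin 4)) (TangentSpace (𝓡 4) : M → Type _),
      ∃ _ : g.HasLeviCivita, g.IsRiemannian ∧ (∀ x, 0 < g.scalarCurvature x) ∧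
        g.weylEnergy < ENNReal.ofReal (32 * Real.pi ^ 2)) →
    Nonempty (M ≃ₘ⟮𝓡 4, 𝓡 4⟯ Metric.sphere (0 : EuclideanSpace ℝ (Fin 5)) 1)

/-- Pointwise form of the conclusion: under `changGurskyYang_sphere_four`, a compact simply
connected `4`-manifold with a Riemannian metric of positive scalar curvature and Weyl energy
below `32π²` is diffeomorphic to `S⁴` (the fact with its binders instantiated — the shape in which
route SmoothPoincare4/PIC consumes it as hypothesis `hCGY`). [cite: ChangGurskyYang2003, Thm. A] -/
theorem changGurskyYang_sphere_four.diffeomorph_sphere (h : changGurskyYang_sphere_four)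
    (M : Type) [TopologicalSpace M] [T2Space M] [SecondCountableTopology M]
    [ChartedSpace (EuclideanSpace ℝ (Fin 4)) M] [IsManifold (𝓡 4) ∞ M] [CompactSpace M]
    [SimplyConnectedSpace M]
    (g : PseudoRiemannianMetric (𝓡 4) ∞ (EuclideanSpace ℝ (Fin 4)) (TangentSpace (𝓡 4) : M → Type _))
    [g.HasLeviCivita] (hg : g.IsRiemannian) (hscal : ∀ x, 0 < g.scalarCurvature x)
    (hW : g.weylEnergy < ENNReal.ofReal (32 * Real.pi ^ 2)) :
    Nonempty (M ≃ₘ⟮𝓡 4, 𝓡 4⟯ Metric.sphere (0 : EuclideanSpace ℝ (Fin 5)) 1) :=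
  h M ⟨g, ‹g.HasLeviCivita›, hg, hscal, hW⟩

end Literature.Geometry.Riemannian
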